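import Summits.Ventures.LatticeQCDFlow.Scaling.BooleanStarThreeStateValue

/-!
HONEST FRAMING: exact (Metropolis-corrected) sampling algorithms for lattice gauge theory; figures
of merit are autocorrelation/cost numbers at stated couplings and volumes; no continuum-physics
claim.

# BooleanStarLipschitzPotential — OPEN-MATH ITEM 1 (ii) FOR THE HOMOGENEOUS BOOLEAN STAR (ALL `K`) FOLLOWS FROM ONE INEQUALITY: FOR ANY POTENTIAL
# `Ψa(D,N) = 𝟙{D≥1}·(D + φ(N) + φ(N+D))` WITH `φ ≥ 0` `1`-LIPSCHITZ AND THE EXACT THREE-STATE VALUES `U, V, W`, THE REDRAW CONTRACTION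
# `μ_0(b)·U(D,N) + μ_0(b̄)·V(D,N) ≤ (1−ρ)·Ψa(D,N)` GIVES `t_mix(ε) ≤ ⌈(4/((1−t)w_0ρ))·log((eΨ_max+1)/ε)⌉` (lean-2 GEN-32, ours)

Venture-side (OURS).  Cell `lqcd-flow` (pub-lqcd), unit `pub-lqcd-lean-2-g32`, 2026-08-29.  Chapter S, file 7, on top of `BooleanStarThreeStateValue` (S6).  S6 left three
obligations for a potential `Ψa(D,N)`: non-negativity ∕ `Ψa ≥ 1` where a cold level differs, the SEPARATION `max{Ψa(D−1,N+1), Ψa(D−1,N), Ψa(D−2,N+1)} ≤ min{Ψa(D+1,N),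
Ψa(D+1,N−1), Ψa(D,N)}` on `D ≥ 1`, and the redraw contraction.  For the family `Ψa(D,N) = 𝟙{D ≥ 1}·(D + φ(N) + φ(N+D))` — the shape designed in `lean-2/MEMO-gen32-certificate-largeK.md`
§9 (`φ` = a Huber "excess over the equilibrium bad count", `1`-Lipschitz, `≥ 0`) — the first two are identities: each of the nine differences in the separation is
`k − (at most k unit Lipschitz steps of φ) ≥ 0`, `k ∈ {1,2,3}` (and a lower value with first argument `< 1` is `0 ≤` every upper value); the indicator keeps `Ψ = 0` on
coalesced pairs, where the cycle value vanishes too.  So the law for ALL `K` follows from the ONE remaining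
inequality, the redraw contraction, for whichever `φ` the analyst prefers.  Hypothesis-equations throughout; no definitions.

## What is proved

* §0 `huber_nonneg`, `huber_le_abs`, **`huber_lipschitz`** — the Huber function `hub_W` (quadratic inside `|x| ≤ W`, `|x| − W/2` outside) is `≥ 0`, `≤ |x|` and `1`-Lipschitz:
  an admissible `φ(x) = hub_W(x − N*)` in the sense below.
* §1 **`lipschitzPotential_sep`** — the separation for `Ψa = 𝟙{D≥1}(D + φ(N) + φ(N+D))`, `φ ≥ 0` `1`-Lipschitz, `D ∈ {1, 2} ∪ [3, ∞)` (nine linear inequalities from Lipschitz steps).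
* §2 `boolStar_Dc_natCast` (`D` of a configuration is a natural number, `≥ 1` when a cold level differs) and **`boolStar_mixingTime_le_of_lipschitzPotential`**: the setting of S6
  with `Ψa = 𝟙{D≥1}(D + φ(N) + φ(N+D))`, `φ ≥ 0` `1`-Lipschitz, `Ψa ≤ Ψ_max` on configurations, and the REDRAW CONTRACTION at every configuration (`0 < ρ ≤ 1`) ⇒
  `t_mix(ε) ≤ ⌈(4/((1−t)w_0·ρ))·log((e·Ψ_max+1)/ε)⌉₊`.

Reading (no numerics implied): with `φ(x) = hub_W(x − N*)`, `N* = (K+1)μ_1(b̄)`, `W = max{4rK/p², 2}` the memo's toy computations give the contraction with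
`ρ ≥ 0.44·(p/K)·min{1, t/h}` for `K ≤ 256` over all `(μ, r, t/h)` tried; proving it (an explicit inequality between Cramer quotients of the three-state class and `Ψa`) is
what remains of OPEN-MATH item 1 (ii) for the homogeneous Boolean star.  NOT CLAIMED: it; anything measured.  Literature grade (cell rule): OWN, elementary; nothing cited as a
fact; no new bib keys.
-/

noncomputable section

namespace Summit.Ventures.LatticeQCDFlow.Scaling

/-! ## §0 The Huber function `hub_W(x) = x²/(2W)` (`|x| ≤ W`), `|x| − W/2` (`|x| > W`): non-negative, below `|x|`, `1`-Lipschitz -/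

/-- `0 ≤ hub_W(x)` (`W > 0`). [ours] -/
theorem huber_nonneg {W : ℝ} (hW : 0 < W) {φ : ℝ → ℝ} (hφ : ∀ x, φ x = if |x| ≤ W then x ^ 2 / (2 * W) else |x| - W / 2) (x : ℝ) : 0 ≤ φ x := by
  rw [hφ]; split_ifs with h
  · positivity
  · linarith [abs_nonneg x, not_le.mp h]

/-- `hub_W(x) ≤ |x|` (`W > 0`). [ours] -/
theorem huber_le_abs {W : ℝ} (hW : 0 < W) {φ : ℝ → ℝ} (hφ : ∀ x, φ x = if |x| ≤ W then x ^ 2 / (2 * W) else |x| - W / 2) (x : ℝ) : φ x ≤ |x| := by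
  rw [hφ]; split_ifs with h
  · rw [div_le_iff₀ (by linarith), ← sq_abs]
    nlinarith [abs_nonneg x]
  · linarith

/-- **`hub_W` is `1`-Lipschitz** (`W > 0`): four cases; in the mixed case `|y| − W/2 − x²/(2W) ≤ |y| − |x|` because `(W − |x|)² ≥ 0`. [ours] -/
theorem huber_lipschitz {W : ℝ} (hW : 0 < W) {φ : ℝ → ℝ} (hφ : ∀ x, φ x = if |x| ≤ W then x ^ 2 / (2 * W) else |x| - W / 2) (x y : ℝ) :
    |φ x - φ y| ≤ |x - y| := by
  have hxy : |(|x| - |y|)| ≤ |x - y| := abs_abs_sub_abs_le_abs_sub x y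
  have key : ∀ u v : ℝ, |u| ≤ W → W < |v| → |u ^ 2 / (2 * W) - (|v| - W / 2)| ≤ |u - v| := by
    intro u v hu hv
    have h1 : u ^ 2 / (2 * W) ≤ W / 2 := by rw [div_le_iff₀ (by linarith), ← sq_abs]; nlinarith [abs_nonneg u]
    have h2 : |v| - W / 2 - u ^ 2 / (2 * W) ≤ |v| - |u| := by
      have : W / 2 - |u| + u ^ 2 / (2 * W) = (W - |u|) ^ 2 / (2 * W) := by field_simp; rw [← sq_abs]; ring
      have h3 : 0 ≤ (W - |u|) ^ 2 / (2 * W) := by positivity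
      linarith
    rw [abs_sub_comm, abs_of_nonneg (by linarith)]
    have h4 : |v| - |u| ≤ |u - v| := by
      have := abs_abs_sub_abs_le_abs_sub v u; rw [abs_sub_comm v u] at this; exact (le_abs_self _).trans this
    linarith
  rw [hφ x, hφ y]
  by_cases hx : |x| ≤ W <;> by_cases hy : |y| ≤ W <;> simp only [hx, hy, if_true, if_false]
  · -- both quadratic: `|x² − y²| = |x−y|·|x+y| ≤ |x−y|·2W`
    rw [← sub_div, abs_div, abs_of_pos (by linarith : (0:ℝ) < 2 * W), div_le_iff₀ (by linarith), sq_sub_sq, abs_mul]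
    have h1 : |x + y| ≤ 2 * W := (abs_add_le x y).trans (by linarith)
    have h2 : |x + y| * |x - y| ≤ 2 * W * |x - y| := mul_le_mul_of_nonneg_right h1 (abs_nonneg _)
    linarith
  · exact key x y hx (lt_of_not_ge hy)
  · rw [abs_sub_comm, abs_sub_comm x y]; exact key y x hy (lt_of_not_ge hx)
  · rw [show |x| - W / 2 - (|y| - W / 2) = |x| - |y| by ring]; exact hxy


/-! ## §1 A potential `𝟙{D ≥ 1}·(D + φ(N) + φ(N + D))` with `φ ≥ 0` `1`-Lipschitz separates across `D` -/

/-- **SEPARATION ACROSS `D`:** for `Ψa(D,N) = D + φ(N) + φ(N+D)` on `D ≥ 1` and `0` below, with `φ ≥ 0` `1`-Lipschitz, and `D = 1` or `D = 2` or `D ≥ 3`,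
`max{Ψa(D−1,N+1), Ψa(D−1,N), Ψa(D−2,N+1)} ≤ min{Ψa(D+1,N), Ψa(D+1,N−1), Ψa(D,N)}`. [ours] -/
theorem lipschitzPotential_sep {φ : ℝ → ℝ} {Ψa : ℝ → ℝ → ℝ} (hφ0 : ∀ x, 0 ≤ φ x) (hφ : ∀ x y, |φ x - φ y| ≤ |x - y|)
    (hΨ : ∀ D N, Ψa D N = if 1 ≤ D then D + φ N + φ (N + D) else 0) {D N : ℝ} (hD : D = 1 ∨ D = 2 ∨ 3 ≤ D) :
    max (Ψa (D - 1) (N + 1)) (max (Ψa (D - 1) N) (Ψa (D - 2) (N + 1)))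
      ≤ min (Ψa (D + 1) N) (min (Ψa (D + 1) (N - 1)) (Ψa D N)) := by
  have L : ∀ x y, φ x - φ y ≤ |x - y| := fun x y => (le_abs_self _).trans (hφ x y)
  have hD1 : 1 ≤ D := by rcases hD with h | h | h <;> linarith
  -- the three upper values (all with first argument ≥ 1)
  have A1 : Ψa (D + 1) N = D + 1 + φ N + φ (N + (D + 1)) := by rw [hΨ, if_pos (by linarith)]
  have A2 : Ψa (D + 1) (N - 1) = D + 1 + φ (N - 1) + φ (N - 1 + (D + 1)) := by rw [hΨ, if_pos (by linarith)]
  have A3 : Ψa D N = D + φ N + φ (N + D) := by rw [hΨ, if_pos hD1]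
  -- Lipschitz steps used below
  have l1 := L (N + 1) N; have l4 := L (N + 1) (N - 1); have l5 := L N (N - 1)
  have l2 := L (N + (D - 1)) (N + D); have l3 := L (N + (D - 1)) (N + (D + 1)); have l6 := L (N + (D - 1)) (N + D)
  have l7 := L (N + 1 + (D - 1)) (N + (D + 1))
  have m2 := L (N + 1 + (D - 2)) (N + (D + 1)); have m5 := L (N + 1 + (D - 2)) (N + D)
  rw [show N + 1 - N = 1 by ring, abs_one] at l1
  rw [show N + 1 - (N - 1) = 2 by ring] at l4; norm_num at l4
  rw [show N - (N - 1) = 1 by ring, abs_one] at l5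
  rw [show N + (D - 1) - (N + D) = -1 by ring] at l2 l6; norm_num at l2 l6
  rw [show N + (D - 1) - (N + (D + 1)) = -2 by ring] at l3; norm_num at l3
  rw [show N + 1 + (D - 1) - (N + (D + 1)) = -1 by ring] at l7; norm_num at l7
  rw [show N + 1 + (D - 2) - (N + (D + 1)) = -2 by ring] at m2; norm_num at m2
  rw [show N + 1 + (D - 2) - (N + D) = -1 by ring] at m5; norm_num at m5
  have eND : N - 1 + (D + 1) = N + D := by ring
  have eND' : N + 1 + (D - 1) = N + D := by ring
  rw [eND] at A2
  have p1 := hφ0 N; have p2 := hφ0 (N + D); have p3 := hφ0 (N - 1); have p4 := hφ0 (N + (D + 1))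
  simp only [A1, A2, A3, max_le_iff, le_min_iff]
  -- the three lower values: each is either `0` (first argument < 1) or the formula
  have B1 : Ψa (D - 1) (N + 1) ≤ max 0 (D - 1 + φ (N + 1) + φ (N + 1 + (D - 1))) := by
    rw [hΨ]; split_ifs
    · exact le_max_right _ _
    · exact le_max_left _ _
  have B2 : Ψa (D - 1) N ≤ max 0 (D - 1 + φ N + φ (N + (D - 1))) := by
    rw [hΨ]; split_ifs
    · exact le_max_right _ _
    · exact le_max_left _ _
  have B3 : Ψa (D - 2) (N + 1) ≤ max 0 (D - 2 + φ (N + 1) + φ (N + 1 + (D - 2))) := by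
    rw [hΨ]; split_ifs
    · exact le_max_right _ _
    · exact le_max_left _ _
  rw [eND'] at B1
  refine ⟨⟨?_, ?_, ?_⟩, ⟨?_, ?_, ?_⟩, ⟨?_, ?_, ?_⟩⟩ <;>
    first
    | exact B1.trans (max_le (by linarith) (by linarith))
    | exact B2.trans (max_le (by linarith) (by linarith))
    | exact B3.trans (max_le (by linarith) (by linarith))


/-! ## §2 The law for `Ψa = 𝟙{D ≥ 1}(D + φ(N) + φ(N + D))`: only the redraw contraction remains -/

section Law
open Finset Function Matrix
open Literature.Probability.MarkovChains

variable {K m : ℕ} {μ : Fin (K + 1) → Bool → ℝ} {M : Fin (K + 1) → Bool → Bool → ℝ} {w : Fin (K + 1) → ℝ} {t : ℝ}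
variable (κ : Fin m → Fin K) {cnt : (Fin (K + 1) → Bool) × (Fin (K + 1) → Bool) → Bool → Bool → ℝ}

omit κ in
/-- A pair that differs at a cold level has a defect of one of the two orientations: `D ≥ 1`; and `D` is a natural number. [ours] -/
theorem boolStar_Dc_natCast (hcnt : ∀ a s t, cnt a s t = ((univ.filter fun i : Fin K => a.1 i.succ = s ∧ a.2 i.succ = t).card : ℝ))
    {b : Bool} {Dc : (Bool → Bool → ℝ) → ℝ} (hD : ∀ c, Dc c = c b (!b) + c (!b) b) (a : (Fin (K + 1) → Bool) × (Fin (K + 1) → Bool)) :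
    (∃ n : ℕ, Dc (cnt a) = n) ∧ ((∃ i : Fin K, a.1 i.succ ≠ a.2 i.succ) → 1 ≤ Dc (cnt a)) := by
  refine ⟨⟨(univ.filter fun i : Fin K => a.1 i.succ = b ∧ a.2 i.succ = !b).card
      + (univ.filter fun i : Fin K => a.1 i.succ = !b ∧ a.2 i.succ = b).card, by rw [hD, hcnt, hcnt]; push_cast; ring⟩, ?_⟩
  rintro ⟨i, hi⟩
  rw [hD, hcnt, hcnt]
  have h0 : ∀ s t', (0 : ℝ) ≤ ((univ.filter fun j : Fin K => a.1 j.succ = s ∧ a.2 j.succ = t').card : ℝ) := fun s t' => Nat.cast_nonneg _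
  have key : ∀ s : Bool, a.1 i.succ = s → a.2 i.succ = !s → (1 : ℝ) ≤ ((univ.filter fun j : Fin K => a.1 j.succ = s ∧ a.2 j.succ = !s).card : ℝ) := by
    intro s h1 h2
    have hmem : i ∈ univ.filter fun j : Fin K => a.1 j.succ = s ∧ a.2 j.succ = !s := by simp [h1, h2]
    exact_mod_cast Finset.one_le_card.mpr ⟨i, hmem⟩
  rcases Bool.eq_false_or_eq_true (a.1 i.succ) with h1 | h1 <;> rcases Bool.eq_false_or_eq_true (a.2 i.succ) with h2 | h2
  · exact absurd (h1.trans h2.symm) hi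
  · cases b
    · have := key true h1 (by rw [h2]; rfl); simp only [Bool.not_false, Bool.not_true] at this ⊢; linarith [h0 false true]
    · have := key true h1 (by rw [h2]; rfl); simp only [Bool.not_true] at this ⊢; linarith [h0 false true]
  · cases b
    · have := key false h1 (by rw [h2]; rfl); simp only [Bool.not_false] at this ⊢; linarith [h0 true false]
    · have := key false h1 (by rw [h2]; rfl); simp only [Bool.not_false, Bool.not_true] at this ⊢; linarith [h0 true false]
  · exact absurd (h1.trans h2.symm) hi

/-- **OPEN-MATH ITEM 1 (ii) FOR THE HOMOGENEOUS BOOLEAN STAR ⇐ ONE INEQUALITY.**  Setting of `boolStar_mixingTime_le_of_potential` (S6) with the potential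
`Ψa(D,N) = 𝟙{D ≥ 1}·(D + φ(N) + φ(N+D))` for ANY `φ ≥ 0` that is `1`-Lipschitz (the memo's designed Huber excess term is one such), `U, V, W` the exact three-state values, and a bound
`Ψa ≤ Ψ_max` on configurations: the separation, `Ψa ≥ 0`, and `Ψa ≥ 1` where a cold level differs are discharged here, so **the law `t_mix(ε) ≤ ⌈(4/((1−t)w_0ρ))·log((eΨ_max+1)/ε)⌉₊`
follows from the single REDRAW CONTRACTION `μ_0(b)·U(D,N) + μ_0(b̄)·V(D,N) ≤ (1−ρ)·Ψa(D,N)` at every configuration** (`0 < ρ ≤ 1`). [ours] -/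
theorem boolStar_mixingTime_le_of_lipschitzPotential (hm : 1 ≤ m) (ht0 : 0 ≤ t) (ht1 : t < 1) (hw0 : ∀ k, 0 ≤ w k) (hw00 : 0 < w 0)
    (hw1 : ∑ k, w k = 1) (hμ : ∀ k x, 0 < μ k x) (hμ1 : ∀ k, ∑ u, μ k u = 1) (hM0 : ∀ u v, M 0 u v = μ 0 v)
    (hidle : ∀ i : Fin K, ∀ u v, M i.succ u v = if v = u then 1 else 0) (hhom : ∀ i : Fin K, μ i.succ = μ 1)
    {c0 : ℕ} (hunif : ∀ i : Fin K, (univ.filter fun r : Fin m => κ r = i).card = c0)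
    {b : Bool} (hb : μ 0 b * μ 1 (!b) ≤ μ 0 (!b) * μ 1 b) {rr : ℝ} (hrr : rr = μ 0 b * μ 1 (!b) / (μ 0 (!b) * μ 1 b))
    (hcnt : ∀ a s t, cnt a s t = ((univ.filter fun i : Fin K => a.1 i.succ = s ∧ a.2 i.succ = t).card : ℝ))
    {Dc Nc : (Bool → Bool → ℝ) → ℝ} (hD : ∀ c, Dc c = c b (!b) + c (!b) b) (hN : ∀ c, Nc c = c (!b) (!b))
    {φ : ℝ → ℝ} (hφ0 : ∀ x, 0 ≤ φ x) (hφ : ∀ x y, |φ x - φ y| ≤ |x - y|)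
    {Ψa : ℝ → ℝ → ℝ} (hΨ : ∀ D N, Ψa D N = if 1 ≤ D then D + φ N + φ (N + D) else 0) {Ψmax ρ : ℝ}
    {p1 p2 p3 det detu detv detw : ℝ → ℝ → ℝ → ℝ}
    (hp1 : ∀ G N D, p1 G N D = t + (1 - t) * w 0 - t / K * G)
    (hp2 : ∀ G N D, p2 G N D = t + (1 - t) * w 0 - t / K * ((G + 1) * (1 - rr) + (N - 1) + D * (1 - rr)))
    (hp3 : ∀ G N D, p3 G N D = t + (1 - t) * w 0 - t / K * ((G + 1) * (1 - rr) + (D - 1)))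
    (hdet : ∀ G N D, det G N D = p1 G N D * (p2 G N D * p3 G N D - (t / K * D * rr) * (t / K * N))
      - (t / K) ^ 2 * N * (G + 1) * rr * (p3 G N D + t / K * D * rr) - (t / K) ^ 2 * D * (G + 1) * rr * (t / K * N + p2 G N D))
    (hdetu : ∀ G N D, detu G N D = (1 - t) * w 0 * Ψa D N * (p2 G N D * p3 G N D - (t / K * D * rr) * (t / K * N))
      + (1 - t) * w 0 * Ψa D (N - 1) * (t / K * N * (p3 G N D + t / K * D)) + (1 - t) * w 0 * Ψa (D - 1) N * (t / K * D * (t / K * N * rr + p2 G N D)))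
    (hdetv : ∀ G N D, detv G N D = (1 - t) * w 0 * Ψa D (N - 1) * (p1 G N D * p3 G N D - (t / K) ^ 2 * D * (G + 1) * rr)
      + (1 - t) * w 0 * Ψa D N * (t / K * (G + 1) * rr * (p3 G N D + t / K * D * rr))
      + (1 - t) * w 0 * Ψa (D - 1) N * (t / K * D * rr * (p1 G N D + t / K * (G + 1))))
    (hdetw : ∀ G N D, detw G N D = (1 - t) * w 0 * Ψa (D - 1) N * (p1 G N D * p2 G N D - (t / K) ^ 2 * N * (G + 1) * rr)
      + (1 - t) * w 0 * Ψa D (N - 1) * (t / K * N * (p1 G N D + t / K * (G + 1) * rr))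
      + (1 - t) * w 0 * Ψa D N * (t / K * (G + 1) * rr * (t / K * N + p2 G N D)))
    {U V W : ℝ → ℝ → ℝ}
    (hU : ∀ D N, U D N = detu (K - D - N) N D / det (K - D - N) N D)
    (hV : ∀ D N, V D N = detv (K - D - N - 1) (N + 1) D / det (K - D - N - 1) (N + 1) D)
    (hW : ∀ D N, W D N = detw (K - D - N - 1) N (D + 1) / det (K - D - N - 1) N (D + 1))
    (hΨmax : ∀ a : (Fin (K + 1) → Bool) × (Fin (K + 1) → Bool), Ψa (Dc (cnt a)) (Nc (cnt a)) ≤ Ψmax)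
    (hρ0 : 0 < ρ) (hρ1 : ρ ≤ 1)
    (contr : ∀ a : (Fin (K + 1) → Bool) × (Fin (K + 1) → Bool),
      μ 0 b * U (Dc (cnt a)) (Nc (cnt a)) + μ 0 (!b) * V (Dc (cnt a)) (Nc (cnt a)) ≤ (1 - ρ) * Ψa (Dc (cnt a)) (Nc (cnt a)))
    {ε : ℝ} (hε : 0 < ε) :
    mixingTime (fun y z : Fin (K + 1) → Bool =>
        t * ptGraphSwap μ (fun r : Fin m => (((0 : Fin (K + 1)), (κ r).succ) : Fin (K + 1) × Fin (K + 1))) (fun _ : Fin m => Equiv.refl Bool) y z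
          + (1 - t) * prodKernel w M y z) (tensorFun μ) ε
      ≤ ⌈1 / ((1 - t) * w 0 * ρ / 4) * Real.log ((Real.exp 1 * Ψmax + 1) / ε)⌉₊ := by
  have hΨ0 : ∀ D N, 0 ≤ Ψa D N := fun D N => by
    rw [hΨ]; split_ifs with h
    · exact add_nonneg (add_nonneg (by linarith) (hφ0 _)) (hφ0 _)
    · exact le_rfl
  refine boolStar_mixingTime_le_of_potential κ hm ht0 ht1 hw0 hw00 hw1 hμ hμ1 hM0 hidle hhom hunif hb hrr hcnt hD hN
    hp1 hp2 hp3 hdet hdetu hdetv hdetw hU hV hW hΨ0 hΨmax (fun a hex => ?_) hρ0 hρ1 (fun a hD1 => ?_) contr hε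
  · -- `Ψa ≥ 1` where a cold level differs
    have h1 := (boolStar_Dc_natCast hcnt hD a).2 hex
    rw [hΨ, if_pos h1]
    linarith [hφ0 (Nc (cnt a)), hφ0 (Nc (cnt a) + Dc (cnt a))]
  · -- the separation, for a natural `D ≥ 1`
    obtain ⟨n, hn⟩ := (boolStar_Dc_natCast hcnt hD a).1
    refine lipschitzPotential_sep hφ0 hφ hΨ ?_
    rw [hn] at hD1 ⊢
    have hn1 : 1 ≤ n := by exact_mod_cast hD1
    rcases Nat.lt_or_ge n 3 with hlt | hge
    · rcases Nat.lt_or_ge n 2 with hlt2 | hge2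
      · left; exact_mod_cast (show n = 1 by omega)
      · right; left; exact_mod_cast (show n = 2 by omega)
    · right; right; exact_mod_cast hge

end Law

end Summit.Ventures.LatticeQCDFlow.Scaling

end
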